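import Literature.NumberTheory.ModularForms.EtaProductLevelTwentyThreePrimePowers
import HarnessLib

/-!
# The representation numbers `r(Q₀, p^k)`, `r(Q₁, p^k)` of prime powers by the forms of discriminant `−23`
# (van der Blij 1952: `r(Q₀, n) = ⅔ Σ_{d∣n}(d/23) + 4⁄3 t(n)`, `r(Q₁, n) = ⅔ Σ_{d∣n}(d/23) − ⅔ t(n)`; Zagier, *1-2-3*, §4.3 «Θ_{Q₀} = 1 + 2q + 2q⁴ + 4q⁶ + 4q⁸ + ⋯,
# Θ_{Q₁} = 1 + 2q² + 2q³ + 2q⁴ + 2q⁶ + ⋯») — PROVED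

Topic `Literature/NumberTheory/ModularForms`, namespace `Literature.NumberTheory.ModularForms.VanDerBlij` (sequel of
`ThetaSeriesDiscriminantTwentyThreeEisenstein.lean` (`3r(Q₀,n) = 2Σ_{d∣n}(−23/d) + 4a(n)`, `3r(Q₁,n) = 2Σ_{d∣n}(−23/d) − 2a(n)`) and
`EtaProductLevelTwentyThreePrimePowers.lean` (`a(p^k)` in the four cases)).  THEOREMS ONLY (no definition, no named fact, no instance, no notation);
lane `lit-hodgefound` seat p25 gen 53, row g53-#6.

## Sources, VERBATIM

F. van der Blij, *Binary quadratic forms of discriminant −23*, Indag. Math. 14 (1952) 498–503 [vanderBlij1952], as restated in the held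
A. Akbary, Y. Totani, *Binary quadratic forms of odd class number* (arXiv:2408.00184) [AkbaryTotani2024], p. 3 (p0003 of the held text):

> F. van der Blij, in [VDB], gave exact formulas for `a(n, Q)` for all three equivalence classes of binary quadratic forms `Q(x, y)` of discriminant
> `−23` […]. He proved that `a(n, Q₀) = ⅔ Σ_{d∣n} (d/23) + 4⁄3 t(n)` and `a(n, Q₁) = a(n, Q̄₁) = ⅔ Σ_{d∣n} (d/23) − ⅔ t(n)`, where `(·/23)` is the Legendre
> symbol mod `23`, the quadratic forms `Qᵢ`'s are `Q₀(x, y) = x² + xy + 6y²`, `Q₁(x, y) = 2x² + xy + 3y²`, `Q̄₁(x, y) = 2x² − xy + 3y²`, and the coefficients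
> `t(n)` arise out of the formal identity `Σ t(n)qⁿ = q∏(1 − qⁿ)(1 − q²³ⁿ)`. Note that […] `t(n)` can be computed explicitly, and thus the above results
> can be used for the computation `a(n, Q)` […] for any value `n`.

D. Zagier, *The 1-2-3 of Modular Forms* [Zagier2008], §4.3 (held p0058): «`Θ_{Q₀}(z) = 1 + 2q + 2q⁴ + 4q⁶ + 4q⁸ + ⋯`, `Θ_{Q₁}(z) = 1 + 2q² + 2q³ + 2q⁴ + 2q⁶ + ⋯`»
and (47) (`ε₋₂₃(p) = (p/23)`, the four values of `a_p`).

## What is formalised (all PROVED; `r(Q, n) = #{(x,y) ∈ ℤ² : Q(x,y) = n}`, `(−23/d) = J(−23 ∣ d) = (d/23)`)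

* §1 `sum_divisors_prime_pow_jacobiSym` — `Σ_{d ∣ p^k} (−23/d) = Σ_{j ≤ k} ε₋₂₃(p)^j`; its values `k + 1` (`(p/23) = 1`), `[2 ∣ k]` (`(p/23) = −1`), `1` (`p = 23`).
* §2 «`t(n)` can be computed explicitly, and thus … `a(n, Q)`» AT PRIME POWERS:
  ★`ncard_setOf_Q0_prime_pow_of_exists_Q0_eq` / `ncard_setOf_Q1_prime_pow_of_exists_Q0_eq` — `p ≠ 23` represented by `Q₀`: **`r(Q₀, p^k) = 2(k+1)`,
  `r(Q₁, p^k) = 0`**; ★`ncard_setOf_Q0_prime_pow_of_legendreSym_eq_neg_one` / `ncard_setOf_Q1_…` — `(p/23) = −1`: **`r(Q₀, p^k) = 2·[2 ∣ k]`, `r(Q₁, p^k) = 0`**;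
  ★`ncard_setOf_Q0_twentyThree_pow` / `ncard_setOf_Q1_twentyThree_pow` — **`r(Q₀, 23^k) = 2`, `r(Q₁, 23^k) = 0`**; ★`ncard_setOf_Q0_prime_pow_three_mul[_add_one/_add_two]`,
  `ncard_setOf_Q1_prime_pow_three_mul[_add_one/_add_two]` — `p` represented by `Q₁`: **`r(Q₀, p^{3m}) = 2(m+1)`, `r(Q₀, p^{3m+1}) = 2m`, `r(Q₀, p^{3m+2}) = 2(m+1)`;
  `r(Q₁, p^{3m}) = 2m`, `r(Q₁, p^{3m+1}) = 2(m+1)`, `r(Q₁, p^{3m+2}) = 2(m+1)`**.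
* §3 Zagier's displayed coefficients as instances: `r(Q₀, 4) = 2`, `r(Q₀, 8) = 4`, `r(Q₁, 2) = 2`, `r(Q₁, 3) = 2`, `r(Q₁, 4) = 2`, `r(Q₀, 9) = 2`, `r(Q₀, 23) = 2`,
  `r(Q₀, 25) = 2` (validation of the four cases at `2 = Q₁(1,0)`, `3 = Q₁(0,1)`, `(5/23) = −1`, `23`).

## Mathlib / tree search
Tree (consumed BY NAME): `VanDerBlij.{three_mul_ncard_setOf_Q0_eq, three_mul_ncard_setOf_Q1_eq}` (g51-#2), `VanDerBlij.{coeff_etaProduct_twentyThree_pow,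
coeff_etaProduct_prime_pow_of_legendreSym_eq_neg_one, coeff_etaProduct_prime_pow_of_exists_Q0_eq, coeff_etaProduct_prime_pow_of_exists_Q1_eq,
jacobiSym_neg_twentyThree_eq_legendreSym, jacobiSym_neg_twentyThree_twentyThree}` (g53-#1), `VanDerBlij.{legendreSym_eq_one_of_exists_eval_Q0,
legendreSym_eq_one_of_exists_eval_Q1}`.  Mathlib: `Nat.divisors_prime_pow`, `jacobiSym.pow_right`, `Finset.sum_range_succ`, `Even.neg_one_pow`, `Odd.neg_one_pow`.
`rg "ncard_setOf_Q0_prime_pow|v.1 \^ 2 \+ v.1 \* v.2 \+ 6 \* v.2 \^ 2 = \(\(p \^" lean/Literature` → nothing: representation numbers of prime powers are new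
(the tree has the totals `r(Q₀,n) + 2r(Q₁,n)` and the `3r = 2Σ ± …` identities only).

## References
* [vanderBlij1952] F. van der Blij, Binary quadratic forms of discriminant −23, Indag. Math. 14 (1952) 498–503 ((1)–(2) as restated in [AkbaryTotani2024]).
* [AkbaryTotani2024] A. Akbary, Y. Totani, Binary quadratic forms of odd class number, arXiv:2408.00184, p. 3.
* [Zagier2008] D. Zagier, The 1-2-3 of Modular Forms, §4.3, p. 58 and (47).
-/

noncomputable section

open PowerSeries Finset PowerSeries.WithPiTopology
open scoped NumberTheorySymbols
open Literature.NumberTheory.QuadraticFields.VanDerBlij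

namespace Literature.NumberTheory.ModularForms.VanDerBlij

/-! ## §1 `Σ_{d ∣ p^k} (−23/d)` -/

/-- `Σ_{d ∣ p^k} (−23/d) = Σ_{j ≤ k} ε₋₂₃(p)^j` (the `p^k`-coefficient of `ζ(s)L(s, ε₋₂₃)`, the Eisenstein part `f_{χ₀}`).
[cite: Zagier2008, §4.3 (f_{χ₀} = 3/2 + Σ(Σ_{d∣n}(−23/d))qⁿ, p. 58)] -/
theorem sum_divisors_prime_pow_jacobiSym {p : ℕ} (hp : p.Prime) (k : ℕ) :
    ∑ d ∈ (p ^ k).divisors, J(-23 | d) = ∑ j ∈ range (k + 1), J(-23 | p) ^ j := by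
  rw [Nat.divisors_prime_pow hp k, Finset.sum_map]
  refine sum_congr rfl fun j _ => ?_
  exact jacobiSym.pow_right _ _ _

/-- `(p/23) = 1`: `Σ_{d ∣ p^k} (−23/d) = k + 1`. [cite: Zagier2008, §4.3 (p. 58)] -/
theorem sum_divisors_prime_pow_jacobiSym_of_eq_one {p : ℕ} (hp : p.Prime) (hε : J(-23 | p) = 1) (k : ℕ) :
    ∑ d ∈ (p ^ k).divisors, J(-23 | d) = k + 1 := by
  rw [sum_divisors_prime_pow_jacobiSym hp, hε]
  simp

/-- `(p/23) = −1`: `Σ_{d ∣ p^k} (−23/d) = [2 ∣ k]`. [cite: Zagier2008, §4.3 (p. 58)] -/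
theorem sum_divisors_prime_pow_jacobiSym_of_eq_neg_one {p : ℕ} (hp : p.Prime) (hε : J(-23 | p) = -1) (k : ℕ) :
    ∑ d ∈ (p ^ k).divisors, J(-23 | d) = if Even k then 1 else 0 := by
  rw [sum_divisors_prime_pow_jacobiSym hp, hε]
  induction k with
  | zero => simp
  | succ k ih =>
    rw [sum_range_succ, ih]
    rcases Nat.even_or_odd k with he | ho
    · rw [if_pos he, if_neg (Nat.not_even_iff_odd.mpr (Even.add_one he)), Odd.neg_one_pow (Even.add_one he)]
      ring
    · rw [if_neg (Nat.not_even_iff_odd.mpr ho), if_pos (Odd.add_one ho), Even.neg_one_pow (Odd.add_one ho)]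
      ring

/-- `p = 23`: `Σ_{d ∣ 23^k} (−23/d) = 1`. [cite: Zagier2008, §4.3 (p. 58)] -/
theorem sum_divisors_twentyThree_pow_jacobiSym (k : ℕ) : ∑ d ∈ (23 ^ k).divisors, J(-23 | d) = 1 := by
  rw [sum_divisors_prime_pow_jacobiSym (by norm_num) k, jacobiSym_neg_twentyThree_twentyThree, sum_range_succ']
  simp

/-! ## §2 `r(Q₀, p^k)` and `r(Q₁, p^k)` in the four cases -/

/-- **`p ≠ 23` represented by `Q₀`: `r(Q₀, p^k) = 2(k + 1)`** (`3r = 2(k+1) + 4(k+1)`; all the ideals `𝔭ⁱ𝔭̄ʲ` are principal).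
[cite: vanderBlij1952, (1) (via AkbaryTotani2024 p. 3)] [cite: Zagier2008, §4.3 (47) and p. 58] -/
theorem ncard_setOf_Q0_prime_pow_of_exists_Q0_eq [Fact (Nat.Prime 23)] {p : ℕ} (hp : p.Prime) (hp23 : p ≠ 23)
    (h0 : ∃ x y : ℤ, x ^ 2 + x * y + 6 * y ^ 2 = p) (k : ℕ) :
    {v : ℤ × ℤ | v.1 ^ 2 + v.1 * v.2 + 6 * v.2 ^ 2 = ((p ^ k : ℕ) : ℤ)}.ncard = 2 * (k + 1) := by
  have hε : J(-23 | p) = 1 := by rw [jacobiSym_neg_twentyThree_eq_legendreSym hp, legendreSym_eq_one_of_exists_eval_Q0 hp hp23 h0]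
  have h := three_mul_ncard_setOf_Q0_eq (pow_ne_zero k hp.ne_zero)
  rw [sum_divisors_prime_pow_jacobiSym_of_eq_one hp hε, coeff_etaProduct_prime_pow_of_exists_Q0_eq hp hp23 h0] at h
  have h' : (({v : ℤ × ℤ | v.1 ^ 2 + v.1 * v.2 + 6 * v.2 ^ 2 = ((p ^ k : ℕ) : ℤ)}.ncard : ℕ) : ℤ) = 2 * (k + 1) := by linarith
  exact_mod_cast h'

/-- **`p ≠ 23` represented by `Q₀`: `r(Q₁, p^k) = 0`** (`3r = 2(k+1) − 2(k+1)`; no ideal of norm `p^k` lies in a non-trivial class).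
[cite: vanderBlij1952, (2) (via AkbaryTotani2024 p. 3)] [cite: Zagier2008, §4.3 (47) and p. 58] -/
theorem ncard_setOf_Q1_prime_pow_of_exists_Q0_eq [Fact (Nat.Prime 23)] {p : ℕ} (hp : p.Prime) (hp23 : p ≠ 23)
    (h0 : ∃ x y : ℤ, x ^ 2 + x * y + 6 * y ^ 2 = p) (k : ℕ) :
    {v : ℤ × ℤ | 2 * v.1 ^ 2 + v.1 * v.2 + 3 * v.2 ^ 2 = ((p ^ k : ℕ) : ℤ)}.ncard = 0 := by
  have hε : J(-23 | p) = 1 := by rw [jacobiSym_neg_twentyThree_eq_legendreSym hp, legendreSym_eq_one_of_exists_eval_Q0 hp hp23 h0]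
  have h := three_mul_ncard_setOf_Q1_eq (pow_ne_zero k hp.ne_zero)
  rw [sum_divisors_prime_pow_jacobiSym_of_eq_one hp hε, coeff_etaProduct_prime_pow_of_exists_Q0_eq hp hp23 h0] at h
  have h' : (({v : ℤ × ℤ | 2 * v.1 ^ 2 + v.1 * v.2 + 3 * v.2 ^ 2 = ((p ^ k : ℕ) : ℤ)}.ncard : ℕ) : ℤ) = 0 := by linarith
  exact_mod_cast h'

/-- **`(p/23) = −1`: `r(Q₀, p^k) = 2` for even `k` (the points `(±p^{k/2}, 0)`), `0` for odd `k`.**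
[cite: vanderBlij1952, (1) (via AkbaryTotani2024 p. 3)] [cite: Zagier2008, §4.3 (47)] -/
theorem ncard_setOf_Q0_prime_pow_of_legendreSym_eq_neg_one [Fact (Nat.Prime 23)] {p : ℕ} (hp : p.Prime) (hl : legendreSym 23 p = -1)
    (k : ℕ) : {v : ℤ × ℤ | v.1 ^ 2 + v.1 * v.2 + 6 * v.2 ^ 2 = ((p ^ k : ℕ) : ℤ)}.ncard = if Even k then 2 else 0 := by
  have hε : J(-23 | p) = -1 := by rw [jacobiSym_neg_twentyThree_eq_legendreSym hp, hl]
  have h := three_mul_ncard_setOf_Q0_eq (pow_ne_zero k hp.ne_zero)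
  rw [sum_divisors_prime_pow_jacobiSym_of_eq_neg_one hp hε, coeff_etaProduct_prime_pow_of_legendreSym_eq_neg_one hp hl] at h
  split_ifs at h ⊢ with he
  · have h' : (({v : ℤ × ℤ | v.1 ^ 2 + v.1 * v.2 + 6 * v.2 ^ 2 = ((p ^ k : ℕ) : ℤ)}.ncard : ℕ) : ℤ) = 2 := by linarith
    exact_mod_cast h'
  · have h' : (({v : ℤ × ℤ | v.1 ^ 2 + v.1 * v.2 + 6 * v.2 ^ 2 = ((p ^ k : ℕ) : ℤ)}.ncard : ℕ) : ℤ) = 0 := by linarith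
    exact_mod_cast h'

/-- **`(p/23) = −1`: `r(Q₁, p^k) = 0`.** [cite: vanderBlij1952, (2) (via AkbaryTotani2024 p. 3)] [cite: Zagier2008, §4.3 (47)] -/
theorem ncard_setOf_Q1_prime_pow_of_legendreSym_eq_neg_one [Fact (Nat.Prime 23)] {p : ℕ} (hp : p.Prime) (hl : legendreSym 23 p = -1)
    (k : ℕ) : {v : ℤ × ℤ | 2 * v.1 ^ 2 + v.1 * v.2 + 3 * v.2 ^ 2 = ((p ^ k : ℕ) : ℤ)}.ncard = 0 := by
  have hε : J(-23 | p) = -1 := by rw [jacobiSym_neg_twentyThree_eq_legendreSym hp, hl]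
  have h := three_mul_ncard_setOf_Q1_eq (pow_ne_zero k hp.ne_zero)
  rw [sum_divisors_prime_pow_jacobiSym_of_eq_neg_one hp hε, coeff_etaProduct_prime_pow_of_legendreSym_eq_neg_one hp hl] at h
  have h' : (({v : ℤ × ℤ | 2 * v.1 ^ 2 + v.1 * v.2 + 3 * v.2 ^ 2 = ((p ^ k : ℕ) : ℤ)}.ncard : ℕ) : ℤ) = 0 := by
    split_ifs at h <;> linarith
  exact_mod_cast h'

/-- **`p = 23`: `r(Q₀, 23^k) = 2`** (`3r = 2 + 4`). [cite: vanderBlij1952, (1) (via AkbaryTotani2024 p. 3)] [cite: Zagier2008, §4.3 (47)] -/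
theorem ncard_setOf_Q0_twentyThree_pow (k : ℕ) :
    {v : ℤ × ℤ | v.1 ^ 2 + v.1 * v.2 + 6 * v.2 ^ 2 = ((23 ^ k : ℕ) : ℤ)}.ncard = 2 := by
  have h := three_mul_ncard_setOf_Q0_eq (pow_ne_zero k (by norm_num : (23 : ℕ) ≠ 0))
  rw [sum_divisors_twentyThree_pow_jacobiSym, coeff_etaProduct_twentyThree_pow] at h
  have h' : (({v : ℤ × ℤ | v.1 ^ 2 + v.1 * v.2 + 6 * v.2 ^ 2 = ((23 ^ k : ℕ) : ℤ)}.ncard : ℕ) : ℤ) = 2 := by linarith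
  exact_mod_cast h'

/-- **`p = 23`: `r(Q₁, 23^k) = 0`** (`3r = 2 − 2`). [cite: vanderBlij1952, (2) (via AkbaryTotani2024 p. 3)] [cite: Zagier2008, §4.3 (47)] -/
theorem ncard_setOf_Q1_twentyThree_pow (k : ℕ) :
    {v : ℤ × ℤ | 2 * v.1 ^ 2 + v.1 * v.2 + 3 * v.2 ^ 2 = ((23 ^ k : ℕ) : ℤ)}.ncard = 0 := by
  have h := three_mul_ncard_setOf_Q1_eq (pow_ne_zero k (by norm_num : (23 : ℕ) ≠ 0))
  rw [sum_divisors_twentyThree_pow_jacobiSym, coeff_etaProduct_twentyThree_pow] at h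
  have h' : (({v : ℤ × ℤ | 2 * v.1 ^ 2 + v.1 * v.2 + 3 * v.2 ^ 2 = ((23 ^ k : ℕ) : ℤ)}.ncard : ℕ) : ℤ) = 0 := by linarith
  exact_mod_cast h'

/-- `(p/23) = 1` for a prime represented by `Q₁` (so `Σ_{d ∣ p^k}(−23/d) = k + 1`). [cite: Zagier2008, §4.3 (47)] -/
private theorem jacobiSym_eq_one_of_exists_Q1_eq [Fact (Nat.Prime 23)] {p : ℕ} (hp : p.Prime)
    (h1 : ∃ x y : ℤ, 2 * x ^ 2 + x * y + 3 * y ^ 2 = p) : J(-23 | p) = 1 := by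
  rw [jacobiSym_neg_twentyThree_eq_legendreSym hp, legendreSym_eq_one_of_exists_eval_Q1 hp h1]

/-- **`p` represented by `Q₁`: `r(Q₀, p^{3m}) = 2(m + 1)`** (`a(p^{3m}) = 1`). [cite: vanderBlij1952, (1) (via AkbaryTotani2024 p. 3)]
[cite: Zagier2008, §4.3 (47) and p. 58 («4q⁸»: p = 2, m = 1)] -/
theorem ncard_setOf_Q0_prime_pow_three_mul [Fact (Nat.Prime 23)] {p : ℕ} (hp : p.Prime)
    (h1 : ∃ x y : ℤ, 2 * x ^ 2 + x * y + 3 * y ^ 2 = p) (m : ℕ) :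
    {v : ℤ × ℤ | v.1 ^ 2 + v.1 * v.2 + 6 * v.2 ^ 2 = ((p ^ (3 * m) : ℕ) : ℤ)}.ncard = 2 * (m + 1) := by
  have h := three_mul_ncard_setOf_Q0_eq (pow_ne_zero (3 * m) hp.ne_zero)
  rw [sum_divisors_prime_pow_jacobiSym_of_eq_one hp (jacobiSym_eq_one_of_exists_Q1_eq hp h1),
    coeff_etaProduct_prime_pow_three_mul hp h1] at h
  have h' : (({v : ℤ × ℤ | v.1 ^ 2 + v.1 * v.2 + 6 * v.2 ^ 2 = ((p ^ (3 * m) : ℕ) : ℤ)}.ncard : ℕ) : ℤ) = 2 * (m + 1) := by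
    have hm : ((3 * m : ℕ) : ℤ) = 3 * (m : ℤ) := by push_cast; ring
    linarith
  exact_mod_cast h'

/-- **`p` represented by `Q₁`: `r(Q₀, p^{3m+1}) = 2m`** (`a(p^{3m+1}) = −1`; in particular `r(Q₀, p) = 0`).
[cite: vanderBlij1952, (1) (via AkbaryTotani2024 p. 3)] [cite: Zagier2008, §4.3 (47)] -/
theorem ncard_setOf_Q0_prime_pow_three_mul_add_one [Fact (Nat.Prime 23)] {p : ℕ} (hp : p.Prime)
    (h1 : ∃ x y : ℤ, 2 * x ^ 2 + x * y + 3 * y ^ 2 = p) (m : ℕ) :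
    {v : ℤ × ℤ | v.1 ^ 2 + v.1 * v.2 + 6 * v.2 ^ 2 = ((p ^ (3 * m + 1) : ℕ) : ℤ)}.ncard = 2 * m := by
  have h := three_mul_ncard_setOf_Q0_eq (pow_ne_zero (3 * m + 1) hp.ne_zero)
  rw [sum_divisors_prime_pow_jacobiSym_of_eq_one hp (jacobiSym_eq_one_of_exists_Q1_eq hp h1),
    coeff_etaProduct_prime_pow_three_mul_add_one hp h1] at h
  have h' : (({v : ℤ × ℤ | v.1 ^ 2 + v.1 * v.2 + 6 * v.2 ^ 2 = ((p ^ (3 * m + 1) : ℕ) : ℤ)}.ncard : ℕ) : ℤ) = 2 * m := by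
    have hm : ((3 * m + 1 : ℕ) : ℤ) = 3 * (m : ℤ) + 1 := by push_cast; ring
    linarith
  exact_mod_cast h'

/-- **`p` represented by `Q₁`: `r(Q₀, p^{3m+2}) = 2(m + 1)`** (`a(p^{3m+2}) = 0`; e.g. `r(Q₀, 4) = 2`).
[cite: vanderBlij1952, (1) (via AkbaryTotani2024 p. 3)] [cite: Zagier2008, §4.3 (47) and p. 58 («2q⁴»)] -/
theorem ncard_setOf_Q0_prime_pow_three_mul_add_two [Fact (Nat.Prime 23)] {p : ℕ} (hp : p.Prime)
    (h1 : ∃ x y : ℤ, 2 * x ^ 2 + x * y + 3 * y ^ 2 = p) (m : ℕ) :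
    {v : ℤ × ℤ | v.1 ^ 2 + v.1 * v.2 + 6 * v.2 ^ 2 = ((p ^ (3 * m + 2) : ℕ) : ℤ)}.ncard = 2 * (m + 1) := by
  have h := three_mul_ncard_setOf_Q0_eq (pow_ne_zero (3 * m + 2) hp.ne_zero)
  rw [sum_divisors_prime_pow_jacobiSym_of_eq_one hp (jacobiSym_eq_one_of_exists_Q1_eq hp h1),
    coeff_etaProduct_prime_pow_three_mul_add_two hp h1] at h
  have h' : (({v : ℤ × ℤ | v.1 ^ 2 + v.1 * v.2 + 6 * v.2 ^ 2 = ((p ^ (3 * m + 2) : ℕ) : ℤ)}.ncard : ℕ) : ℤ) = 2 * (m + 1) := by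
    have hm : ((3 * m + 2 : ℕ) : ℤ) = 3 * (m : ℤ) + 2 := by push_cast; ring
    linarith
  exact_mod_cast h'

/-- **`p` represented by `Q₁`: `r(Q₁, p^{3m}) = 2m`** (in particular `r(Q₁, 1) = 0`).
[cite: vanderBlij1952, (2) (via AkbaryTotani2024 p. 3)] [cite: Zagier2008, §4.3 (47)] -/
theorem ncard_setOf_Q1_prime_pow_three_mul [Fact (Nat.Prime 23)] {p : ℕ} (hp : p.Prime)
    (h1 : ∃ x y : ℤ, 2 * x ^ 2 + x * y + 3 * y ^ 2 = p) (m : ℕ) :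
    {v : ℤ × ℤ | 2 * v.1 ^ 2 + v.1 * v.2 + 3 * v.2 ^ 2 = ((p ^ (3 * m) : ℕ) : ℤ)}.ncard = 2 * m := by
  have h := three_mul_ncard_setOf_Q1_eq (pow_ne_zero (3 * m) hp.ne_zero)
  rw [sum_divisors_prime_pow_jacobiSym_of_eq_one hp (jacobiSym_eq_one_of_exists_Q1_eq hp h1),
    coeff_etaProduct_prime_pow_three_mul hp h1] at h
  have h' : (({v : ℤ × ℤ | 2 * v.1 ^ 2 + v.1 * v.2 + 3 * v.2 ^ 2 = ((p ^ (3 * m) : ℕ) : ℤ)}.ncard : ℕ) : ℤ) = 2 * m := by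
    have hm : ((3 * m : ℕ) : ℤ) = 3 * (m : ℤ) := by push_cast; ring
    linarith
  exact_mod_cast h'

/-- **`p` represented by `Q₁`: `r(Q₁, p^{3m+1}) = 2(m + 1)`** (e.g. `r(Q₁, 2) = r(Q₁, 3) = 2`).
[cite: vanderBlij1952, (2) (via AkbaryTotani2024 p. 3)] [cite: Zagier2008, §4.3 (47) and p. 58 («2q² + 2q³»)] -/
theorem ncard_setOf_Q1_prime_pow_three_mul_add_one [Fact (Nat.Prime 23)] {p : ℕ} (hp : p.Prime)
    (h1 : ∃ x y : ℤ, 2 * x ^ 2 + x * y + 3 * y ^ 2 = p) (m : ℕ) :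
    {v : ℤ × ℤ | 2 * v.1 ^ 2 + v.1 * v.2 + 3 * v.2 ^ 2 = ((p ^ (3 * m + 1) : ℕ) : ℤ)}.ncard = 2 * (m + 1) := by
  have h := three_mul_ncard_setOf_Q1_eq (pow_ne_zero (3 * m + 1) hp.ne_zero)
  rw [sum_divisors_prime_pow_jacobiSym_of_eq_one hp (jacobiSym_eq_one_of_exists_Q1_eq hp h1),
    coeff_etaProduct_prime_pow_three_mul_add_one hp h1] at h
  have h' : (({v : ℤ × ℤ | 2 * v.1 ^ 2 + v.1 * v.2 + 3 * v.2 ^ 2 = ((p ^ (3 * m + 1) : ℕ) : ℤ)}.ncard : ℕ) : ℤ) = 2 * (m + 1) := by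
    have hm : ((3 * m + 1 : ℕ) : ℤ) = 3 * (m : ℤ) + 1 := by push_cast; ring
    linarith
  exact_mod_cast h'

/-- **`p` represented by `Q₁`: `r(Q₁, p^{3m+2}) = 2(m + 1)`** (e.g. `r(Q₁, 4) = 2`).
[cite: vanderBlij1952, (2) (via AkbaryTotani2024 p. 3)] [cite: Zagier2008, §4.3 (47) and p. 58 («2q⁴»)] -/
theorem ncard_setOf_Q1_prime_pow_three_mul_add_two [Fact (Nat.Prime 23)] {p : ℕ} (hp : p.Prime)
    (h1 : ∃ x y : ℤ, 2 * x ^ 2 + x * y + 3 * y ^ 2 = p) (m : ℕ) :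
    {v : ℤ × ℤ | 2 * v.1 ^ 2 + v.1 * v.2 + 3 * v.2 ^ 2 = ((p ^ (3 * m + 2) : ℕ) : ℤ)}.ncard = 2 * (m + 1) := by
  have h := three_mul_ncard_setOf_Q1_eq (pow_ne_zero (3 * m + 2) hp.ne_zero)
  rw [sum_divisors_prime_pow_jacobiSym_of_eq_one hp (jacobiSym_eq_one_of_exists_Q1_eq hp h1),
    coeff_etaProduct_prime_pow_three_mul_add_two hp h1] at h
  have h' : (({v : ℤ × ℤ | 2 * v.1 ^ 2 + v.1 * v.2 + 3 * v.2 ^ 2 = ((p ^ (3 * m + 2) : ℕ) : ℤ)}.ncard : ℕ) : ℤ) = 2 * (m + 1) := by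
    have hm : ((3 * m + 2 : ℕ) : ℤ) = 3 * (m : ℤ) + 2 := by push_cast; ring
    linarith
  exact_mod_cast h'

/-! ## §3 Zagier's displayed coefficients of `Θ_{Q₀}` and `Θ_{Q₁}` -/

/-- `r(Q₀, 4) = 2` («`2q⁴`»; `4 = 2²`, `2 = Q₁(1,0)`). [cite: Zagier2008, §4.3 (p. 58, Θ_{Q₀})] -/
theorem ncard_setOf_Q0_four : {v : ℤ × ℤ | v.1 ^ 2 + v.1 * v.2 + 6 * v.2 ^ 2 = 4}.ncard = 2 := by
  haveI : Fact (Nat.Prime 23) := ⟨by norm_num⟩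
  have h := ncard_setOf_Q0_prime_pow_three_mul_add_two Nat.prime_two ⟨1, 0, by norm_num⟩ 0
  norm_num at h
  exact h

/-- `r(Q₀, 8) = 4` («`4q⁸`»; `8 = 2³`). [cite: Zagier2008, §4.3 (p. 58, Θ_{Q₀})] -/
theorem ncard_setOf_Q0_eight : {v : ℤ × ℤ | v.1 ^ 2 + v.1 * v.2 + 6 * v.2 ^ 2 = 8}.ncard = 4 := by
  haveI : Fact (Nat.Prime 23) := ⟨by norm_num⟩
  have h := ncard_setOf_Q0_prime_pow_three_mul Nat.prime_two ⟨1, 0, by norm_num⟩ 1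
  norm_num at h
  exact h

/-- `r(Q₀, 9) = 2` (`9 = 3²`, `3 = Q₁(0,1)`; the points `(±3, 0)`). [cite: Zagier2008, §4.3 (p. 58)] -/
theorem ncard_setOf_Q0_nine : {v : ℤ × ℤ | v.1 ^ 2 + v.1 * v.2 + 6 * v.2 ^ 2 = 9}.ncard = 2 := by
  haveI : Fact (Nat.Prime 23) := ⟨by norm_num⟩
  have h := ncard_setOf_Q0_prime_pow_three_mul_add_two Nat.prime_three ⟨0, 1, by norm_num⟩ 0
  norm_num at h
  exact h

/-- `r(Q₁, 2) = 2` («`2q²`»). [cite: Zagier2008, §4.3 (p. 58, Θ_{Q₁})] -/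
theorem ncard_setOf_Q1_two : {v : ℤ × ℤ | 2 * v.1 ^ 2 + v.1 * v.2 + 3 * v.2 ^ 2 = 2}.ncard = 2 := by
  haveI : Fact (Nat.Prime 23) := ⟨by norm_num⟩
  have h := ncard_setOf_Q1_prime_pow_three_mul_add_one Nat.prime_two ⟨1, 0, by norm_num⟩ 0
  norm_num at h
  exact h

/-- `r(Q₁, 3) = 2` («`2q³`»). [cite: Zagier2008, §4.3 (p. 58, Θ_{Q₁})] -/
theorem ncard_setOf_Q1_three : {v : ℤ × ℤ | 2 * v.1 ^ 2 + v.1 * v.2 + 3 * v.2 ^ 2 = 3}.ncard = 2 := by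
  haveI : Fact (Nat.Prime 23) := ⟨by norm_num⟩
  have h := ncard_setOf_Q1_prime_pow_three_mul_add_one Nat.prime_three ⟨0, 1, by norm_num⟩ 0
  norm_num at h
  exact h

/-- `r(Q₁, 4) = 2` («`2q⁴`»). [cite: Zagier2008, §4.3 (p. 58, Θ_{Q₁})] -/
theorem ncard_setOf_Q1_four : {v : ℤ × ℤ | 2 * v.1 ^ 2 + v.1 * v.2 + 3 * v.2 ^ 2 = 4}.ncard = 2 := by
  haveI : Fact (Nat.Prime 23) := ⟨by norm_num⟩
  have h := ncard_setOf_Q1_prime_pow_three_mul_add_two Nat.prime_two ⟨1, 0, by norm_num⟩ 0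
  norm_num at h
  exact h

/-- `r(Q₀, 25) = 2` (`(5/23) = −1`, even exponent: the points `(±5, 0)`). [cite: Zagier2008, §4.3 (47)] -/
theorem ncard_setOf_Q0_twentyFive : {v : ℤ × ℤ | v.1 ^ 2 + v.1 * v.2 + 6 * v.2 ^ 2 = 25}.ncard = 2 := by
  haveI : Fact (Nat.Prime 23) := ⟨by norm_num⟩
  have h5 : legendreSym 23 (5 : ℕ) = -1 := by norm_num
  have h := ncard_setOf_Q0_prime_pow_of_legendreSym_eq_neg_one (by norm_num : Nat.Prime 5) h5 2
  rw [if_pos even_two] at h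
  norm_num at h
  exact h

/-- `r(Q₀, 23) = 2` (the points `±(−1, 2)`). [cite: Zagier2008, §4.3 (47) («a_p = 1 if p = 23»)] -/
theorem ncard_setOf_Q0_twentyThree : {v : ℤ × ℤ | v.1 ^ 2 + v.1 * v.2 + 6 * v.2 ^ 2 = 23}.ncard = 2 := by
  have h := ncard_setOf_Q0_twentyThree_pow 1
  norm_num at h
  exact h

end Literature.NumberTheory.ModularForms.VanDerBlij
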